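import Literature.AlgebraicGeometry.Resolution.GenericPointStalkData
import Literature.AlgebraicGeometry.Resolution.MaximalPoints
import HarnessLib

/-!
# Crux `PatchingRelPerfect` (stmt-ResolutionOfSingularities-16161), chain W5.2 — F7(β) (β-AX) X3 C-I (M2b-T), (T-h-max): AT A MAXIMAL POINT OF
# THE ZERO SET OF A SECTION THE MAXIMAL IDEAL IS MINIMAL OVER ITS GERM (`…DepthPhaseCContactMaxPoint`)

[OURS · L1 W5.2 · F7(β) (β-AX) X3 C-I (M2b-T) · `D/res-D-repro-1/M2bT-ASSEMBLY-PLAN.md` (T-h); hand res-D-repro-1 AS res-L1-repro-3] The dictionary step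
between the geometry of the contact surface `𝒳 = Z(f) ∩ G` and the Krull brick (`…ContactKrull`: `𝔪 ∈ (f).minimalPrimes ⇒ f ∈ (d)`): if
`η` is a MAXIMAL POINT (tree `maxPoints`: no proper generisation inside) of a set `Z` which contains every generisation of `η` at which the
section `f` vanishes, and `f` vanishes at `η`, then the maximal ideal of `𝒪_{X,η}` is a MINIMAL prime over `(f_η)` — a smaller prime over
`(f_η)` is a proper generisation of `η` (tree `fromSpecStalk_specializes`, `primeOfSpecializes_fromSpecStalk`) at which `f` still vanishes.
Def-free, fact-free; NOT a statement of the manuscript under review; AI-written, weaker than expert review.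

## References
* The Stacks Project, Tag 01J7 (points of `Spec 𝒪_{X,x}` = generisations of `x`). [StacksProject]
-/

-- `Summit.<Summit>.<Sub>.Theorems` with `Sub = Summit` (single-conjunct summit, D-0017)
set_option linter.dupNamespace false

noncomputable section

open CategoryTheory AlgebraicGeometry TopologicalSpace IsLocalRing
open Literature.AlgebraicGeometry.Resolution

namespace Summit.ResolutionOfSingularities.ResolutionOfSingularities.Theorems

namespace ContactMaxPoint

universe u

variable {X : Scheme.{u}}

/-- [OURS · L1 W5.2 · (M2b-T) (T-h-max)] **Vanishing transports along a specialisation through the prime of the generisation**: for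
`ζ ⤳ η`, the germ of `f` at `ζ` is a non-unit iff the germ at `η` lies in `𝔭_ζ`. [cite: StacksProject, Tag 01J7] -/
theorem germ_mem_maximalIdeal_iff_mem_primeOfSpecializes {U : X.Opens} (f : Γ(X, U)) {ζ η : X} (h : ζ ⤳ η) (hηU : η ∈ U) :
    X.presheaf.germ U ζ (h.mem_open U.isOpen hηU) f ∈ maximalIdeal (X.presheaf.stalk ζ) ↔
      X.presheaf.germ U η hηU f ∈ primeOfSpecializes h := by
  rw [primeOfSpecializes, Ideal.mem_comap, ← TopCat.Presheaf.germ_stalkSpecializes_apply X.presheaf hηU h f]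

/-- [OURS · L1 W5.2 · (M2b-T) (T-h-max)] **AT A MAXIMAL POINT OF THE ZERO SET, `𝔪_η` IS A MINIMAL PRIME OVER `(f_η)`.**  Hypotheses: `η` is a
maximal point of `Z`; every generisation of `η` at which `f` vanishes lies in `Z`; `f` vanishes at `η`. [cite: StacksProject, Tag 01J7] -/
theorem maximalIdeal_mem_minimalPrimes_span_germ {U : X.Opens} (f : Γ(X, U)) {η : X} (hηU : η ∈ U) {Z : Set X}
    (hmax : η ∈ maxPoints Z)
    (hZ : ∀ (ζ : X) (h : ζ ⤳ η), X.presheaf.germ U ζ (h.mem_open U.isOpen hηU) f ∈ maximalIdeal (X.presheaf.stalk ζ) → ζ ∈ Z)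
    (hf : X.presheaf.germ U η hηU f ∈ maximalIdeal (X.presheaf.stalk η)) :
    maximalIdeal (X.presheaf.stalk η) ∈ (Ideal.span {X.presheaf.germ U η hηU f}).minimalPrimes := by
  refine ⟨⟨inferInstance, (Ideal.span_singleton_le_iff_mem _).mpr hf⟩, fun q hq hqle => ?_⟩
  obtain ⟨hqprime, hfq⟩ := hq
  -- the generisation `ζ` of `η` defined by the prime `q`
  let qq : Spec (X.presheaf.stalk η) := ⟨q, hqprime⟩
  have hζη : X.fromSpecStalk η qq ⤳ η := fromSpecStalk_specializes qq
  have hpq : primeOfSpecializes hζη = q := primeOfSpecializes_fromSpecStalk qq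
  -- `f` vanishes at `ζ`, so `ζ ∈ Z`, so `ζ = η`
  have hfζ : X.presheaf.germ U _ (hζη.mem_open U.isOpen hηU) f ∈ maximalIdeal _ := by
    rw [germ_mem_maximalIdeal_iff_mem_primeOfSpecializes f hζη hηU, hpq]
    exact hfq (Ideal.mem_span_singleton_self _)
  have heq : X.fromSpecStalk η qq = η := hmax.2 _ (hZ _ hζη hfζ) hζη
  -- hence `q = 𝔭_ζ = 𝔭_η = 𝔪_η`
  have key : ∀ (ζ : X) (h : ζ ⤳ η), ζ = η → primeOfSpecializes h = maximalIdeal (X.presheaf.stalk η) := by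
    intro ζ h hζ
    subst hζ
    exact primeOfSpecializes_refl ζ
  rw [← hpq, key _ hζη heq]

end ContactMaxPoint

end Summit.ResolutionOfSingularities.ResolutionOfSingularities.Theorems

end
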